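import Summits.ABC.IUTFork.DAGTopM
import HarnessLib

/-!
# Kernel DAG index — the apex's admissibility/finiteness inputs `hadm`, `hreal`, `hqreal` reduced (C312-RESIDUAL-PROBE)

PROOF-ONLY companion of `DAGTopM.lean` (abc-iut-c312-2; apex `summit_of_cor312_M`, kernel_hyps = 7: hInd,
hadm, hreal, hqreal, hLic, hΘ, hq), written for abc-iut-dag's row C312-RESIDUAL-PROBE (2026-08-25) by
abc-iut-L4-t17.  THIS FILE PROVES BOOKKEEPING ONLY AND ASSERTS NOTHING about [IUTchIII] Cor. 3.12.

Classification of the three inputs against print (kurims `paper:url-4b091feeb646`, read on the page):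
* `hreal : NegLogThetaReal` = (every hull `U_{j,v_ℚ}` is admissible, i.e. "`−|log(Θ)| < +∞`") ∧ (finite
  support in `(j, v_ℚ)`).  The FIRST conjunct is NOT a hypothesis of Cor. 3.12: the statement writes
  "`−|log(Θ)| ∈ ℝ ∪ {+∞}`" (p. 173 l. 41 ff.) and CONCLUDES "Then it holds that `−|log(Θ)| ∈ ℝ`" (p. 174
  l. 17); the printed PROOF derives it at p. 175 l. 2–5: "one concludes easily from the [easily verified]
  compactness of the `^{1,◦}U_{j,v_ℚ}` …, together with the definition of the log-volume, that the quantity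
  `−|log(Θ)|` is finite".  It coincides with the clause `Uhol_adm` of `hadm` (below: `hreal` follows from
  `hadm` + finite support).  The SECOND conjunct is Prop. 3.9 (iii) p. 117: the global "`M(−)`" consists of
  "elements whose components, indexed by `v_ℚ ∈ V_ℚ`, have zero log-volume for all but finitely many `v_ℚ`"
  and the global log-volume is obtained "by adding the log-volumes of (i) [all but finitely many of which
  are zero!]" — a property of the printed objects that the typed signature (`∑ᶠ` over a bare `T.VQ`) must
  be handed.
* `hqreal : NegLogQReal` = (every `q`-pilot region admissible: "Write `−|log(q)| ∈ ℝ`", p. 174 l. 6) ∧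
  (finite support, Prop. 3.9 (iii)); it follows from `hadm` + finite support
  (`negLogQReal_of_componentwise`, abc-iut-c312-1, `Thm311Regions.lean`).
* `hadm : ComponentAdm` = monotonicity of `μ^log` on admissible regions (Prop. 3.9 (i) p. 115: `μ^log` is
  "the `p_{v_ℚ}`-adic log-volume" on "`M(−)` … the set of nonempty compact open subsets", [AbsTopIII] Prop.
  5.7 (i) — the logarithm of a Haar measure, hence monotone) + admissibility of every possible image, of the
  `q`-pilot region (elements of "`M(−)`" determined by objects, Prop. 3.9 (iii) p. 117) and of the hull
  (= the p. 175 proof claim above).  All four are PROPERTIES OF THE PRINTED OBJECTS that the typed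
  signatures `MRData` (`Adm`, `logvol` bare fields), `LogShells` (bare automorphism sets `stripAut`, `ism`)
  and `PilotNouns` (bare `Set`-valued regions) do not carry — generality artefacts of the signature (class β
  of the probe), NOT dischargeable in the tree today because every landed instance (`Thm311Real2/3.ofShells`,
  `Real.latticeSituation`) takes `Adm`, `logvol` and the regions as BINDERS and `PilotNouns` is not
  instantiated (residual list of `Thm311Real3.lean`); none is an extra (class γ) assumption beyond print.

What is proved: `negLogThetaReal_of_componentwise` (the Θ-analogue of c312-1's `negLogQReal_of_componentwise`)
and `summit_of_cor312_M_finsupp` — the apex with `hreal`, `hqreal` replaced by the two finite-support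
clauses of Prop. 3.9 (iii); so the apex's non-disputed, non-identification inputs are exactly `hadm`
(4 clauses) + finite support (2 clauses), all class β.  HONEST FRAMING: nothing here asserts that abc is
proved or refuted or takes a side on Cor. 3.12; typed ≠ discharged; indexed ≠ endorsed.
-/

noncomputable section

namespace Summit.ABC.IUTFork

namespace Thm311.PilotNouns

variable {T : ThetaIndex} {S : LatticeSituation T} (P : PilotNouns S)

/-- The Θ-side guard `NegLogThetaReal` ("`−|log(Θ)| ∈ ℝ`", [IUTchIII] Cor. 3.12 p. 174 l. 17; derived in
print from "the [easily verified] compactness of the `^{1,◦}U_{j,v_ℚ}`", p. 175 l. 2–5) follows from the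
componentwise admissibility data `ComponentAdm` (its clause `Uhol_adm`) plus finite support per label
(Prop. 3.9 (iii) p. 117 "all but finitely many of which are zero") — the Θ-analogue of
`negLogQReal_of_componentwise`. [claim: Mochizuki2012, status: disputed] -/
theorem negLogThetaReal_of_componentwise (n m : ℤ)
    (h : ∀ (j : T.LabelStar) (vQ : T.VQ), P.ComponentAdm n m j vQ)
    (hθ : ∀ j : T.LabelStar,
      Function.HasFiniteSupport fun vQ => (S.D n).logvol j.1 vQ (P.Uhol n m j vQ)) :
    P.NegLogThetaReal n m := by
  refine ⟨fun j vQ => (h j vQ).Uhol_adm, ?_⟩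
  have : {p : T.LabelStar × T.VQ | (S.D n).logvol p.1.1 p.2 (P.Uhol n m p.1 p.2) ≠ 0} ⊆
      ⋃ j : T.LabelStar, (fun vQ => (j, vQ)) '' Function.support
        (fun vQ => (S.D n).logvol j.1 vQ (P.Uhol n m j vQ)) := by
    rintro ⟨j, vQ⟩ hp
    exact Set.mem_iUnion.2 ⟨j, vQ, hp, rfl⟩
  exact (Set.finite_iUnion fun j => (hθ j).image _).subset this

end Thm311.PilotNouns

namespace DAG

open Cor312Proof Thm311

/-- **The apex with `hreal`, `hqreal` reduced to Prop. 3.9 (iii)'s finite support.** Same route as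
`summit_of_cor312_M` (licence `hLic` = Reading 2 `QSubHull` of Step (xi-f)); the admissibility halves of
`hreal`/`hqreal` come from `hadm` (`Uhol_adm`, `Q_adm`), so the remaining non-disputed, non-identification
inputs are `hadm` and the two finite-support clauses `hθfin`, `hqfin` — all properties of the printed
objects ([IUTchIII] Prop. 3.9 (i) p. 115, (iii) p. 117; proof of Cor. 3.12 p. 175 l. 2–5) that the typed
signatures leave abstract. kernel_hyps = 7 (hInd, hadm, hθfin, hqfin, hLic, hΘ, hq).
[claim: Mochizuki2012, status: disputed] -/
theorem summit_of_cor312_M_finsupp (V : HeightFamily) (T : Thm110Family V) (A : AbcDictionary V)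
    (hInd : MochizukiIndeterminacies T) {TI : V.Pt → ThetaIndex} (S : ∀ P, LatticeSituation (TI P))
    (Pn : ∀ P, PilotNouns (S P)) (n m : ℤ)
    (hadm : ∀ P (j : (TI P).LabelStar) (vQ : (TI P).VQ), (Pn P).ComponentAdm n m j vQ)
    (hθfin : ∀ P (j : (TI P).LabelStar),
      Function.HasFiniteSupport fun vQ => ((S P).D n).logvol j.1 vQ ((Pn P).Uhol n m j vQ))
    (hqfin : ∀ P (j : (TI P).LabelStar),
      Function.HasFiniteSupport fun vQ => ((S P).D n).logvol j.1 vQ ((Pn P).qRegion n m j vQ))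
    (hLic : ∀ P (j : (TI P).LabelStar) (vQ : (TI P).VQ),
      ((Pn P).toCor312Setting n m j vQ (hadm P j vQ)).QSubHull)
    (hΘ : ∀ P, (Pn P).negLogTheta n m = (T.X P).negLogTheta)
    (hq : ∀ P, (Pn P).negLogQ n m = -(T.X P).absLogq) :
    _root_.ABC :=
  summit_of_cor312_M V T A hInd S Pn n m hadm
    (fun P => (Pn P).negLogThetaReal_of_componentwise n m (hadm P) (hθfin P))
    (fun P => (Pn P).negLogQReal_of_componentwise n m (hadm P) (hqfin P))
    hLic hΘ hq

end DAG

end Summit.ABC.IUTFork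

end
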